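import Summits.CriticalPhenomena.PercolationContinuityZ3.Theorems.PercNearOneGluingNoHeavyLowerTailTwoPartitionOnePair
import Summits.CriticalPhenomena.PercolationContinuityZ3.Theorems.PercNearOneGluingNoHeavyLowerTailTwoPartitionPeel
import HarnessLib.Audit

/-!
# `NoHeavyLowerTail` (crux stmt-CriticalPhenomena-4575), master-family hierarchy P3 (gen 30): the HOLE LEMMA (one unit of Harris–Kleitman slack
# from a missing minimal element) and the KLEITMAN SPLIT WITH REMAINDER for `twoPartN` — the two tools behind the `|𝒜 ∩ 𝒜ᶜˢ| ≤ 4` face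

Support file (seat `prim-masterthm-p3`; `--supports stmt-CriticalPhenomena-4575`; memo
`run/shared/lean/prim/prim-masterthm/FROM-prim-masterthm-p3-g30-SPLIT-AND-PEELING.md` §3, HIERARCHY §37).  Companion of `…TwoPartitionOnePair`
(`exists_split_of_harris_eq`, `harris_eq_of_twoPartN_eq_zero`: the Harris–Kleitman equality case), `…TwoPartitionSplit` (`chi`, `fib`, `sum_finset_unit`),
`…TwoPartitionPeel` (layers at a coordinate `i` along `(finSuccEquiv' i).trans optionEquivSumPUnit`).

(1) `twoPartN (𝒜 ∖ 𝒜ᶜˢ) 𝒴 = twoPartN 𝒜 𝒴` (the complementary pairs of `𝒜` are invisible to any `𝒴`), hence the structure identity in the form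
    `threeSetN 𝒜 ℬ 𝒞 = twoPartN 𝒜 (ℬ∩𝒞) + #(Fℬ𝒞) − #(Fℬ𝒞ᶜˢ)`, `F = 𝒜 ∩ 𝒜ᶜˢ` (`threeSetN_eq_twoPartN_self_add`).
(2) **HOLE LEMMA** (`one_le_twoPartN_of_hole`): if `𝒵, 𝒳` are up-sets, `m ∉ 𝒵` but `insert j m ∈ 𝒵` for every `j ∉ m`, `m ∉ 𝒳` and `univ ∈ 𝒳`, then
    `1 ≤ twoPartN 𝒵 𝒳` (if it were `0`, Harris would hold with equality, the cube would split along some `S` with `𝒵` read on `S` and `𝒳` on `Sᶜ`, every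
    `j ∉ m` would lie in `S`, and `univ ∈ 𝒳` would force `m ∈ 𝒳`).  Variant for a MINIMAL element `m ∈ 𝒜` invisible to `𝒴` (`m, mᶜ ∉ 𝒴`):
    `one_le_twoPartN_of_minimal` (`twoPartN 𝒜 𝒴 = twoPartN (𝒜.erase m) 𝒴 ≥ 1`).
(3) **KLEITMAN SPLIT WITH REMAINDER** (`twoPartN_fib_add_fib_add_rung_le`): on `ι ⊕ Unit`,
    `twoPartN 𝒳₀ 𝒴₀ + twoPartN 𝒳₁ 𝒴₁ + (χ_{𝒳₁}(e) − χ_{𝒳₀}(e))(χ_{𝒴₁}(eᶜ) − χ_{𝒴₀}(eᶜ)) ≤ twoPartN 𝒳 𝒴` for every `e` — Harris' induction identity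
    `N₂ = N₂(layer 0) + N₂(layer 1) + Σ_e ΔX(e)ΔY(eᶜ)` with one nonnegative rung kept; plus `famMap_univ`, `twoPartN_famMap`, and the pull-back lemmas
    `map_pull_succAbove` (`(j ↦ i.succAbove j)`-preimage of `a` maps onto `a.erase i`) used to read layer members at a coordinate `i : Fin (n+1)`.
HONEST LABEL: tools; no new face in this file. [this work]
-/

namespace Summit.CriticalPhenomena.PercolationContinuityZ3.Theorems.TwoPartition

open Finset
open scoped FinsetFamily

section General

variable {α : Type*} [DecidableEq α] [Fintype α]

/-- The complementary pairs inside `𝒜` are invisible to the sandwich: `twoPartN (𝒜 ∖ 𝒜ᶜˢ) 𝒴 = twoPartN 𝒜 𝒴`. [this work] -/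
theorem twoPartN_sdiff_compls_eq (𝒜 𝒴 : Finset (Finset α)) : twoPartN (𝒜 \ 𝒜ᶜˢ) 𝒴 = twoPartN 𝒜 𝒴 := by
  rw [twoPartN_eq_sum, twoPartN_eq_sum, ← sub_eq_zero]
  simp only [chi_sdiff, chi_compls, ← Finset.sum_sub_distrib]
  refine sum_eq_zero_of_compl_antisymm _ fun S => ?_
  simp only [compl_compl]
  ring

/-- Structure identity, second form: `threeSetN 𝒜 ℬ 𝒞 = twoPartN 𝒜 (ℬ∩𝒞) + #(𝒜∩𝒜ᶜˢ∩ℬ∩𝒞) − #(𝒜∩𝒜ᶜˢ∩ℬ∩𝒞ᶜˢ)`. [this work] -/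
theorem threeSetN_eq_twoPartN_self_add (𝒜 ℬ 𝒞 : Finset (Finset α)) :
    threeSetN 𝒜 ℬ 𝒞 = twoPartN 𝒜 (ℬ ∩ 𝒞) + #(𝒜 ∩ 𝒜ᶜˢ ∩ ℬ ∩ 𝒞) - #(𝒜 ∩ 𝒜ᶜˢ ∩ ℬ ∩ 𝒞ᶜˢ) := by
  rw [threeSetN_eq_twoPartN_add, twoPartN_sdiff_compls_eq]

/-- **Hole lemma** (this work): a missing point `m` all of whose immediate successors are in the up-set `𝒵` forces one unit of Harris–Kleitman
slack against every up-set `𝒳 ∋ univ` avoiding `m`. [this work] -/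
theorem one_le_twoPartN_of_hole {𝒵 𝒳 : Finset (Finset α)} (h𝒵 : IsUpperSet (𝒵 : Set (Finset α))) (h𝒳 : IsUpperSet (𝒳 : Set (Finset α)))
    {m : Finset α} (hm : m ∉ 𝒵) (hsucc : ∀ j ∉ m, insert j m ∈ 𝒵) (hmX : m ∉ 𝒳) (huniv : (univ : Finset α) ∈ 𝒳) :
    1 ≤ twoPartN 𝒵 𝒳 := by
  have h0 : 0 ≤ twoPartN 𝒵 𝒳 := twoPartN_nonneg h𝒵 h𝒳
  by_contra hlt
  have hz : twoPartN 𝒵 𝒳 = 0 := by omega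
  obtain ⟨S, hZS, hXS⟩ := exists_split_of_harris_eq h𝒵 h𝒳 (harris_eq_of_twoPartN_eq_zero h𝒵 h𝒳 hz)
  -- every coordinate outside `m` is in `S`
  have hSc : Sᶜ ⊆ (m : Set α) := by
    intro j hj
    by_contra hjm
    have hjm' : j ∉ m := hjm
    have hagree : ((insert j m : Finset α) : Set α) ∩ S = (m : Set α) ∩ S := by
      ext x
      simp only [Set.mem_inter_iff, mem_coe, mem_insert]
      constructor
      · rintro ⟨hx | hx, hxS⟩
        · subst hx; exact absurd hxS hj
        · exact ⟨hx, hxS⟩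
      · rintro ⟨hx, hxS⟩; exact ⟨Or.inr hx, hxS⟩
    exact hm ((hZS _ _ hagree).1 (hsucc j hjm'))
  have hagree : ((univ : Finset α) : Set α) ∩ Sᶜ = (m : Set α) ∩ Sᶜ := by
    ext x
    simp only [Set.mem_inter_iff, coe_univ, Set.mem_univ, true_and, mem_coe]
    exact ⟨fun hx => ⟨hSc hx, hx⟩, fun h => h.2⟩
  exact hmX ((hXS _ _ hagree).1 huniv)

/-- Erasing an element that is invisible to `𝒴` (neither it nor its complement lies in `𝒴`) does not change the sandwich. [this work] -/
theorem twoPartN_erase_eq {𝒜 𝒴 : Finset (Finset α)} {m : Finset α} (h1 : m ∉ 𝒴) (h2 : mᶜ ∉ 𝒴) :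
    twoPartN (𝒜.erase m) 𝒴 = twoPartN 𝒜 𝒴 := by
  unfold twoPartN
  rw [erase_inter, erase_inter, erase_eq_of_notMem, erase_eq_of_notMem]
  · rw [mem_inter, mem_compls]; exact fun h => h2 h.2
  · rw [mem_inter]; exact fun h => h1 h.2

omit [Fintype α] in
/-- Erasing a minimal element of an up-set leaves an up-set. [this work] -/
theorem isUpperSet_erase_of_minimal {𝒜 : Finset (Finset α)} (h𝒜 : IsUpperSet (𝒜 : Set (Finset α))) {m : Finset α}
    (hmin : ∀ S ∈ 𝒜, ¬ S ⊂ m) : IsUpperSet ((𝒜.erase m : Finset (Finset α)) : Set (Finset α)) := by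
  intro S T hST hS
  rw [Finset.mem_coe, mem_erase] at hS ⊢
  refine ⟨?_, h𝒜 hST hS.2⟩
  rintro rfl
  exact hmin S hS.2 (lt_of_le_of_ne hST hS.1)

/-- **One unit of slack from an invisible minimal element** (this work): if `m ∈ 𝒜` is minimal, `m, mᶜ ∉ 𝒴`, and `univ ∈ 𝒴`, then
`1 ≤ twoPartN 𝒜 𝒴`. [this work] -/
theorem one_le_twoPartN_of_minimal {𝒜 𝒴 : Finset (Finset α)} (h𝒜 : IsUpperSet (𝒜 : Set (Finset α))) (h𝒴 : IsUpperSet (𝒴 : Set (Finset α)))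
    {m : Finset α} (hm : m ∈ 𝒜) (hmin : ∀ S ∈ 𝒜, ¬ S ⊂ m) (h1 : m ∉ 𝒴) (h2 : mᶜ ∉ 𝒴) (huniv : (univ : Finset α) ∈ 𝒴) :
    1 ≤ twoPartN 𝒜 𝒴 := by
  rw [← twoPartN_erase_eq h1 h2]
  refine one_le_twoPartN_of_hole (isUpperSet_erase_of_minimal h𝒜 hmin) h𝒴 (fun h => (mem_erase.1 h).1 rfl) (fun j hj => ?_) h1 huniv
  exact mem_erase.2 ⟨fun h => hj (h ▸ mem_insert_self j m), h𝒜 (subset_insert j m) hm⟩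

/-! ### `famMap` and `twoPartN` -/

/-- `famMap` of the full family is the full family. [folklore] -/
theorem famMap_univ {β γ : Type*} [DecidableEq β] [Fintype β] [DecidableEq γ] [Fintype γ] (e : β ≃ γ) :
    famMap e (univ : Finset (Finset β)) = univ :=
  eq_univ_of_forall fun _ => mem_famMap.2 (mem_univ _)

/-- `twoPartN` is invariant under relabelling the ground set. [this work] -/
theorem twoPartN_famMap {β γ : Type*} [DecidableEq β] [Fintype β] [DecidableEq γ] [Fintype γ] (e : β ≃ γ) (ℬ 𝒞 : Finset (Finset β)) :
    twoPartN (famMap e ℬ) (famMap e 𝒞) = twoPartN ℬ 𝒞 := by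
  rw [← threeSetN_univ_left, ← threeSetN_univ_left, ← famMap_univ e, threeSetN_famMap]

end General

/-! ### The Kleitman split with one rung kept -/

section KleitmanSplit

variable {ι : Type*} [DecidableEq ι] [Fintype ι]

/-- **Kleitman split with remainder** (this work): for up-sets `𝒳, 𝒴` of `2^(ι ⊕ Unit)` and any `e ⊆ ι`,
`twoPartN 𝒳₀ 𝒴₀ + twoPartN 𝒳₁ 𝒴₁ + (χ_{𝒳₁}(e) − χ_{𝒳₀}(e))·(χ_{𝒴₁}(eᶜ) − χ_{𝒴₀}(eᶜ)) ≤ twoPartN 𝒳 𝒴` — Harris' induction identity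
`N₂ = N₂⁰ + N₂¹ + Σ_e ΔX(e)ΔY(eᶜ)` with all rungs nonnegative and the rung at `e` kept. [this work] -/
theorem twoPartN_fib_add_fib_add_rung_le {𝒳 𝒴 : Finset (Finset (ι ⊕ Unit))} (h𝒳 : IsUpperSet (𝒳 : Set (Finset (ι ⊕ Unit))))
    (h𝒴 : IsUpperSet (𝒴 : Set (Finset (ι ⊕ Unit)))) (e : Finset ι) :
    twoPartN (fib 𝒳 ∅) (fib 𝒴 ∅) + twoPartN (fib 𝒳 univ) (fib 𝒴 univ)
      + (chi 𝒳 (e.disjSum (univ : Finset Unit)) - chi 𝒳 (e.disjSum (∅ : Finset Unit)))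
        * (chi 𝒴 (eᶜ.disjSum (univ : Finset Unit)) - chi 𝒴 (eᶜ.disjSum (∅ : Finset Unit)))
      ≤ twoPartN 𝒳 𝒴 := by
  set x : Finset Unit → Finset ι → ℤ := fun q e => chi 𝒳 (e.disjSum q) with hx_def
  set y : Finset Unit → Finset ι → ℤ := fun q e => chi 𝒴 (e.disjSum q) with hy_def
  let T : Finset ι → Finset Unit → ℤ := fun e q => x q e * y q e - x q e * y qᶜ eᶜ
  let L : Finset Unit → Finset ι → ℤ := fun q e => x q e * y q e - x q e * y q eᶜ
  let ρ : Finset ι → ℤ := fun e => (x univ e - x ∅ e) * (y univ eᶜ - y ∅ eᶜ)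
  have hN : twoPartN 𝒳 𝒴 = ∑ e : Finset ι, (T e ∅ + T e univ) := by
    rw [twoPartN_eq_sum, sum_finset_sum_eq]
    refine Finset.sum_congr rfl fun e _ => ?_
    rw [sum_finset_unit]
    simp only [T, compl_disjSum, hx_def, hy_def, Finset.compl_empty, Finset.compl_univ]
  have hL : ∀ q : Finset Unit, twoPartN (fib 𝒳 q) (fib 𝒴 q) = ∑ e : Finset ι, L q e := by
    intro q
    rw [twoPartN_eq_sum]
    simp only [chi_fib, L, hx_def, hy_def]
  have key : ∀ e' : Finset ι, T e' ∅ + T e' univ - (L ∅ e' + L univ e') = ρ e' := by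
    intro e'
    simp only [T, L, ρ, Finset.compl_empty, Finset.compl_univ]
    ring
  have hρ : ∀ e' : Finset ι, 0 ≤ ρ e' := fun e' =>
    mul_nonneg (sub_nonneg.2 (chi_fib_empty_le h𝒳 e')) (sub_nonneg.2 (chi_fib_empty_le h𝒴 e'ᶜ))
  have hdiff : twoPartN 𝒳 𝒴 - (twoPartN (fib 𝒳 ∅) (fib 𝒴 ∅) + twoPartN (fib 𝒳 univ) (fib 𝒴 univ)) = ∑ e' : Finset ι, ρ e' := by
    rw [hN, hL, hL, ← Finset.sum_add_distrib, ← Finset.sum_sub_distrib]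
    exact Finset.sum_congr rfl fun e' _ => key e'
  have hsingle : ρ e ≤ ∑ e' : Finset ι, ρ e' := Finset.single_le_sum (fun e' _ => hρ e') (mem_univ e)
  have hρe : ρ e = (chi 𝒳 (e.disjSum (univ : Finset Unit)) - chi 𝒳 (e.disjSum (∅ : Finset Unit)))
      * (chi 𝒴 (eᶜ.disjSum (univ : Finset Unit)) - chi 𝒴 (eᶜ.disjSum (∅ : Finset Unit))) := rfl
  linarith

end KleitmanSplit

/-! ### Reading layer members at a coordinate `i : Fin (n+1)` -/

section Pull

variable {n : ℕ}

/-- The pull-back of `a ⊆ [n+1]` along `succAbove i` maps onto `a.erase i`. [this work] -/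
theorem map_pull_succAbove (i : Fin (n + 1)) (a : Finset (Fin (n + 1))) :
    (univ.filter fun j => i.succAbove j ∈ a).map (Fin.succAboveEmb i) = a.erase i := by
  ext x
  rw [Finset.mem_map, mem_erase]
  constructor
  · rintro ⟨j, hj, rfl⟩
    exact ⟨Fin.succAbove_ne i j, (mem_filter.1 hj).2⟩
  · rintro ⟨hxi, hx⟩
    obtain ⟨j, rfl⟩ := Fin.exists_succAbove_eq hxi
    exact ⟨j, mem_filter.2 ⟨mem_univ _, hx⟩, rfl⟩

/-- The pull-back of the complement is the complement of the pull-back. [this work] -/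
theorem pull_compl (i : Fin (n + 1)) (a : Finset (Fin (n + 1))) :
    (univ.filter fun j => i.succAbove j ∈ a)ᶜ = univ.filter fun j => i.succAbove j ∈ aᶜ := by
  ext j; simp [mem_compl]

/-- Layer-0 membership of a pulled-back set: for `i ∉ a`, the pull-back of `a` lies in `𝒜_i⁰` iff `a ∈ 𝒜`. [this work] -/
theorem pull_mem_fib_empty_iff (i : Fin (n + 1)) (𝒜 : Finset (Finset (Fin (n + 1)))) {a : Finset (Fin (n + 1))} (hi : i ∉ a) :
    (univ.filter fun j => i.succAbove j ∈ a) ∈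
        fib (famMap ((finSuccEquiv' i).trans (Equiv.optionEquivSumPUnit.{0, 0} (Fin n))) 𝒜) (∅ : Finset Unit) ↔ a ∈ 𝒜 := by
  rw [mem_fib_splitAt_empty, map_pull_succAbove, erase_eq_of_notMem hi]

/-- Layer-1 membership of a pulled-back set: the pull-back of `a` lies in `𝒜_i¹` iff `insert i a ∈ 𝒜`. [this work] -/
theorem pull_mem_fib_univ_iff (i : Fin (n + 1)) (𝒜 : Finset (Finset (Fin (n + 1)))) (a : Finset (Fin (n + 1))) :
    (univ.filter fun j => i.succAbove j ∈ a) ∈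
        fib (famMap ((finSuccEquiv' i).trans (Equiv.optionEquivSumPUnit.{0, 0} (Fin n))) 𝒜) (univ : Finset Unit) ↔ insert i a ∈ 𝒜 := by
  rw [mem_fib_splitAt_univ, map_pull_succAbove]
  have h : insert i (a.erase i) = insert i a := by
    ext x
    rw [mem_insert, mem_insert, mem_erase]
    by_cases hx : x = i
    · simp [hx]
    · simp [hx]
  rw [h]

end Pull

end Summit.CriticalPhenomena.PercolationContinuityZ3.Theorems.TwoPartition
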